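import Mathlib.Analysis.SpecialFunctions.Trigonometric.Bounds
import Mathlib.Analysis.Real.Pi.Bounds
import Mathlib.Algebra.BigOperators.Intervals
import HarnessLib

/-!
# Joint level/support bound — real-analysis toolkit (line `joint-level-support-bound`)

HONEST FRAMING. Part of the venture `Summits/Ventures/Crystal3D` (cell `crystal3d-full`), helper
`--supports` the crux `NoReconstructionGain` (stmt-Ventures-19144, route
`route-Ventures-StickyWulffConstant`), line `joint-level-support-bound` (the sphere-geometry stubs
`stub_jointBound_deepHeavy` / `stub_jointBound_levelHeavy`).  Pure real analysis, no geometry: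

* `cos_ge_double_half`, `cos_ge_sin_cube` — explicit polynomial LOWER bounds for `cos t` (two
  half-angle steps from `1 - x²/2 ≤ cos x`; `cos t = sin (π/2 - t) ≥ s - s³/6`), used to certify
  numerically the angular thresholds of the azimuthal-gap method;
* `lt_of_cos_lt_cos_of_nonneg` — `cos x < cos τ`, `0 ≤ x`, `τ ≤ π` ⟹ `τ < x`;
* `sep_deep_core` — the deep–deep azimuthal separation in algebraic form: for `c > 0`,
  `a₁ ≥ a_lo ≥ 1/2`, `a₂ ≥ 1/2`, `ρᵢ = √(1 - aᵢ²) > 0` and `a_lo (1 + 3c²) > 1 - 3c²`: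
  `c ρ₁ ρ₂ + a₁ a₂ > 1/2` (so two deep contact directions at depths `a₁, a₂` below `-ν` whose
  azimuths differ by an angle of cosine `≥ c` are closer than `60°`);
* `sep_level_core`, `sep_level_level_core` — the deep–level and level–level analogues;
* `weighted_cycle` — the bookkeeping of the weighted azimuthal cycle: consecutive gaps bounded below
  by sums of weights force `2·Σ weights < 2π`.

WHAT THIS IS NOT: any statement about packings; rung F-C1 not moved.
-/

noncomputable section

namespace Summit.Ventures.Crystal3D.Theorems

open Finset Real

/-! ### Numeric lower bounds for the cosine -/

/-- Two half-angle steps from `1 - x²/2 ≤ cos x`: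
`cos t ≥ 2 (2 (1 - t²/32)² - 1)² - 1` whenever the two inner brackets are nonnegative. -/
theorem cos_ge_double_half (t : ℝ) (h1 : 0 ≤ 1 - t ^ 2 / 32)
    (h2 : 0 ≤ 2 * (1 - t ^ 2 / 32) ^ 2 - 1) :
    2 * (2 * (1 - t ^ 2 / 32) ^ 2 - 1) ^ 2 - 1 ≤ Real.cos t := by
  have h4 : 1 - t ^ 2 / 32 ≤ Real.cos (t / 4) := by
    have := Real.one_sub_sq_div_two_le_cos (x := t / 4)
    have e : 1 - (t / 4) ^ 2 / 2 = 1 - t ^ 2 / 32 := by ring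
    linarith
  have hsq4 : (1 - t ^ 2 / 32) ^ 2 ≤ Real.cos (t / 4) ^ 2 := pow_le_pow_left₀ h1 h4 2
  have hhalf2 : Real.cos (t / 2) = 2 * Real.cos (t / 4) ^ 2 - 1 := by
    have := Real.cos_sq (t / 4)
    rw [show 2 * (t / 4) = t / 2 by ring] at this
    linarith
  have h2' : 2 * (1 - t ^ 2 / 32) ^ 2 - 1 ≤ Real.cos (t / 2) := by rw [hhalf2]; linarith
  have hsq2 : (2 * (1 - t ^ 2 / 32) ^ 2 - 1) ^ 2 ≤ Real.cos (t / 2) ^ 2 := pow_le_pow_left₀ h2 h2' 2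
  have hhalf : Real.cos t = 2 * Real.cos (t / 2) ^ 2 - 1 := by
    have := Real.cos_sq (t / 2)
    rw [show 2 * (t / 2) = t by ring] at this
    linarith
  rw [hhalf]; linarith

/-- `cos t = sin (π/2 - t) ≥ s₀ - s₀³/6` for `0 ≤ s₀ ≤ π/2 - t ≤ 1`. -/
theorem cos_ge_sin_cube (t s₀ : ℝ) (h0 : 0 ≤ s₀) (h1 : s₀ ≤ Real.pi / 2 - t)
    (h2 : Real.pi / 2 - t ≤ 1) : s₀ - s₀ ^ 3 / 6 ≤ Real.cos t := by
  rw [← Real.sin_pi_div_two_sub]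
  set s := Real.pi / 2 - t with hs
  have hsin : s - s ^ 3 / 6 ≤ Real.sin s := Real.sin_ge_sub_cube (le_trans h0 h1)
  have hmono : s₀ - s₀ ^ 3 / 6 ≤ s - s ^ 3 / 6 := by
    have hd : 0 ≤ s - s₀ := by linarith
    have hq : 0 ≤ 6 - (s ^ 2 + s * s₀ + s₀ ^ 2) := by nlinarith
    nlinarith [mul_nonneg hd hq]
  linarith

/-- `cos x < cos τ` with `0 ≤ x` and `τ ≤ π` forces `τ < x`. -/
theorem lt_of_cos_lt_cos_of_nonneg {x τ : ℝ} (hx : 0 ≤ x) (hτ : τ ≤ Real.pi)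
    (h : Real.cos x < Real.cos τ) : τ < x := by
  by_contra hc
  push Not at hc
  have := Real.cos_le_cos_of_nonneg_of_le_pi hx hτ hc
  linarith

/-! ### The numeric thresholds of the line (radians) -/

/-- `cos 1.228 > 0.336` (deep–deep threshold `τ_dd ≈ 70.36°`; needed `> 1/3`). -/
theorem cos_tdd_gt : (0.336 : ℝ) < Real.cos 1.228 := by
  have hpi := Real.pi_gt_d6
  have hpi' := Real.pi_lt_d6
  have h := cos_ge_sin_cube 1.228 0.342796 (by norm_num) (by linarith) (by linarith)
  have : (0.336 : ℝ) < 0.342796 - 0.342796 ^ 3 / 6 := by norm_num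
  linarith

/-- `cos 1.3125 > 0.2554` (threshold `τ_aD ≈ 75.2°` for gaps next to a deep direction of depth
`> 0.682`). -/
theorem cos_taD_gt : (0.2554 : ℝ) < Real.cos 1.3125 := by
  have hpi := Real.pi_gt_d6
  have hpi' := Real.pi_lt_d6
  have h := cos_ge_sin_cube 1.3125 0.258296 (by norm_num) (by linarith) (by linarith)
  have : (0.2554 : ℝ) < 0.258296 - 0.258296 ^ 3 / 6 := by norm_num
  linarith

/-- `cos 1.2741 > 0.2923` (threshold `τ_aM ≈ 73.0°` for gaps next to a deep direction of depth
`> 0.602`). -/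
theorem cos_taM_gt : (0.2923 : ℝ) < Real.cos 1.2741 := by
  have hpi := Real.pi_gt_d6
  have hpi' := Real.pi_lt_d6
  have h := cos_ge_sin_cube 1.2741 0.296696 (by norm_num) (by linarith) (by linarith)
  have : (0.2923 : ℝ) < 0.296696 - 0.296696 ^ 3 / 6 := by norm_num
  linarith

/-- `cos 1.05 > 0.497` (threshold `τ₆ ≈ 60.2°` for six deep directions). -/
theorem cos_t6_gt : (0.497 : ℝ) < Real.cos 1.05 := by
  have hpi := Real.pi_gt_d6
  have hpi' := Real.pi_lt_d6
  have h := cos_ge_sin_cube 1.05 0.520796 (by norm_num) (by linarith) (by linarith)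
  have : (0.497 : ℝ) < 0.520796 - 0.520796 ^ 3 / 6 := by norm_num
  linarith

/-- `cos 0.6702 > 0.7831` (level clearance `τ_CM ≈ 38.4°` next to a deep direction of depth
`≤ 0.682`). -/
theorem cos_tCM_gt : (0.7831 : ℝ) < Real.cos 0.6702 := by
  have h := cos_ge_double_half 0.6702 (by norm_num) (by norm_num)
  have : (0.7831 : ℝ) < 2 * (2 * (1 - (0.6702 : ℝ) ^ 2 / 32) ^ 2 - 1) ^ 2 - 1 := by norm_num
  linarith

/-- `cos 0.7837 > 0.7073` (level clearance `τ_CS ≈ 44.9°` next to a deep direction of depth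
`≤ 0.602`). -/
theorem cos_tCS_gt : (0.7073 : ℝ) < Real.cos 0.7837 := by
  have h := cos_ge_double_half 0.7837 (by norm_num) (by norm_num)
  have : (0.7073 : ℝ) < 2 * (2 * (1 - (0.7837 : ℝ) ^ 2 / 32) ^ 2 - 1) ^ 2 - 1 := by norm_num
  linarith

/-- `cos 0.872 > 0.6418` (level clearance `τ_dl ≈ 49.96°` next to a deep direction at depth
exactly `1/2`). -/
theorem cos_tdl_gt : (0.6418 : ℝ) < Real.cos 0.872 := by
  have h := cos_ge_double_half 0.872 (by norm_num) (by norm_num)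
  have : (0.6418 : ℝ) < 2 * (2 * (1 - (0.872 : ℝ) ^ 2 / 32) ^ 2 - 1) ^ 2 - 1 := by norm_num
  linarith

/-- `cos 0.516 > 0.86` (the small level weight `2 w_L = 2 τ_dl - τ_dd`). -/
theorem cos_tll_gt : (0.86 : ℝ) < Real.cos 0.516 := by
  have h := Real.one_sub_sq_div_two_le_cos (x := (0.516 : ℝ))
  have : (0.86 : ℝ) < 1 - (0.516 : ℝ) ^ 2 / 2 := by norm_num
  linarith

/-! ### Separation cores -/

/-- **Deep–deep separation core.**  `c > 0`, `1/2 ≤ a_lo ≤ a₁`, `1/2 ≤ a₂`, `ρᵢ > 0`,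
`aᵢ² + ρᵢ² = 1`, and `1 - 3c² < a_lo (1 + 3c²)`: then `1/2 < c ρ₁ ρ₂ + a₁ a₂`.  (Two deep contact
directions `(ρᵢ cos θᵢ, ρᵢ sin θᵢ, -aᵢ)` with `cos (θ₁ - θ₂) ≥ c` would have inner product `> 1/2`.)
Proof: either `a₁ a₂ ≥ 1/2`, or compare squares using `a₁ + a₂ ≤ 2 a₁ a₂ + 1/2` and the factorisation
`c² (3/4 - 3p²) - (1/2 - p)² = (1/2 - p)((3c² + 1) p - (1 - 3c²)/2)`, `p = a₁ a₂ ≥ a_lo / 2`. -/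
theorem sep_deep_core (c alo a₁ a₂ ρ₁ ρ₂ : ℝ) (hc : 0 < c) (halo : 1 / 2 ≤ alo)
    (hcond : 1 - 3 * c ^ 2 < alo * (1 + 3 * c ^ 2)) (ha₁ : alo ≤ a₁) (ha₂ : 1 / 2 ≤ a₂)
    (hρ₁ : 0 < ρ₁) (hρ₂ : 0 < ρ₂) (h₁ : a₁ ^ 2 + ρ₁ ^ 2 = 1) (h₂ : a₂ ^ 2 + ρ₂ ^ 2 = 1) :
    1 / 2 < c * (ρ₁ * ρ₂) + a₁ * a₂ := by
  have hpos : 0 < c * (ρ₁ * ρ₂) := by positivity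
  by_cases hp : 1 / 2 ≤ a₁ * a₂
  · linarith
  push Not at hp
  obtain ⟨p, hpdef⟩ : ∃ p : ℝ, p = a₁ * a₂ := ⟨_, rfl⟩
  rw [← hpdef] at hp ⊢
  have ha₁' : 1 / 2 ≤ a₁ := le_trans halo ha₁
  have hplo : alo / 2 ≤ p := by rw [hpdef]; nlinarith
  have hs : a₁ + a₂ ≤ 2 * p + 1 / 2 := by
    rw [hpdef]; nlinarith [mul_nonneg (sub_nonneg.2 ha₁') (sub_nonneg.2 ha₂)]
  have hs0 : 0 ≤ a₁ + a₂ := by linarith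
  have hsq : (a₁ + a₂) ^ 2 ≤ (2 * p + 1 / 2) ^ 2 := pow_le_pow_left₀ hs0 hs 2
  have hprod : (ρ₁ * ρ₂) ^ 2 = 1 - (a₁ + a₂) ^ 2 + 2 * p + p ^ 2 := by
    rw [mul_pow, show ρ₁ ^ 2 = 1 - a₁ ^ 2 by linarith, show ρ₂ ^ 2 = 1 - a₂ ^ 2 by linarith, hpdef]
    ring
  have hc2 : 0 < c ^ 2 := by positivity
  have hlow : c ^ 2 * (3 / 4 - 3 * p ^ 2) ≤ (c * (ρ₁ * ρ₂)) ^ 2 := by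
    rw [show (c * (ρ₁ * ρ₂)) ^ 2 = c ^ 2 * (ρ₁ * ρ₂) ^ 2 by ring, hprod]
    have : 3 / 4 - 3 * p ^ 2 ≤ 1 - (a₁ + a₂) ^ 2 + 2 * p + p ^ 2 := by nlinarith
    exact mul_le_mul_of_nonneg_left this hc2.le
  have hG : (1 / 2 - p) ^ 2 < c ^ 2 * (3 / 4 - 3 * p ^ 2) := by
    have hf1 : 0 < 1 / 2 - p := by linarith
    have hf2 : 0 < (3 * c ^ 2 + 1) * p - (1 - 3 * c ^ 2) / 2 := by nlinarith
    have key : c ^ 2 * (3 / 4 - 3 * p ^ 2) - (1 / 2 - p) ^ 2 =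
        (1 / 2 - p) * ((3 * c ^ 2 + 1) * p - (1 - 3 * c ^ 2) / 2) := by ring
    nlinarith [mul_pos hf1 hf2]
  have hlt : (1 / 2 - p) ^ 2 < (c * (ρ₁ * ρ₂)) ^ 2 := lt_of_lt_of_le hG hlow
  have := lt_of_pow_lt_pow_left₀ 2 hpos.le hlt
  linarith

/-- **Deep–level clearance core.**  `c > 0`, `1/2 ≤ a ≤ a_hi`, `|h| ≤ 1/10`, `a² + ρd² = 1`,
`h² + ρl² = 1`, `ρd, ρl ≥ 0`, and `(1/2 + a_hi/10)² < c² (99/100) (1 - a_hi²)`: then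
`1/2 < c ρd ρl - a h`.  (A deep direction of depth `a` and a `1/10`-level direction whose azimuths
differ by an angle of cosine `≥ c` would have inner product `> 1/2`.) -/
theorem sep_level_core (c ahi a h ρd ρl : ℝ) (hc : 0 < c)
    (hcond : (1 / 2 + ahi / 10) ^ 2 < c ^ 2 * (99 / 100) * (1 - ahi ^ 2))
    (ha : 1 / 2 ≤ a) (ha' : a ≤ ahi) (hh : |h| ≤ 1 / 10) (hρd : 0 ≤ ρd) (hρl : 0 ≤ ρl)
    (hd : a ^ 2 + ρd ^ 2 = 1) (hl : h ^ 2 + ρl ^ 2 = 1) :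
    1 / 2 < c * (ρd * ρl) - a * h := by
  have hh1 := (abs_le.1 hh).1
  have hh2 := (abs_le.1 hh).2
  have ha0 : 0 ≤ a := by linarith
  have hah : a * h ≤ a / 10 := by nlinarith
  have hhsq : h ^ 2 ≤ 1 / 100 := by nlinarith
  have hρl2 : 99 / 100 ≤ ρl ^ 2 := by linarith
  have hρd2 : 1 - ahi ^ 2 ≤ ρd ^ 2 := by nlinarith
  have hahi1 : 0 < 1 - ahi ^ 2 := by
    by_contra hneg
    push Not at hneg
    have : c ^ 2 * (99 / 100) * (1 - ahi ^ 2) ≤ 0 :=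
      mul_nonpos_of_nonneg_of_nonpos (by positivity) hneg
    nlinarith [sq_nonneg (1 / 2 + ahi / 10)]
  have hc2 : 0 < c ^ 2 := by positivity
  have key : (1 / 2 + a / 10) ^ 2 < (c * (ρd * ρl)) ^ 2 := by
    have e : (c * (ρd * ρl)) ^ 2 = c ^ 2 * (ρd ^ 2 * ρl ^ 2) := by ring
    rw [e]
    have h3 : (1 - ahi ^ 2) * (99 / 100) ≤ ρd ^ 2 * ρl ^ 2 :=
      mul_le_mul hρd2 hρl2 (by norm_num) (sq_nonneg _)
    have h4 : c ^ 2 * (99 / 100) * (1 - ahi ^ 2) ≤ c ^ 2 * (ρd ^ 2 * ρl ^ 2) := by nlinarith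
    have h5 : (1 / 2 + a / 10) ^ 2 ≤ (1 / 2 + ahi / 10) ^ 2 := by nlinarith
    linarith
  have hpos : 0 ≤ c * (ρd * ρl) := by positivity
  have := lt_of_pow_lt_pow_left₀ 2 hpos key
  linarith

/-- **Level–level separation core.**  Two `1/10`-level directions whose azimuths differ by an angle
of cosine `≥ c ≥ 0.52` have inner product `> 1/2`: `1/2 < c ρ ρ' + h h'`. -/
theorem sep_level_level_core (c h h' ρ ρ' : ℝ) (hc : 52 / 100 ≤ c) (hh : |h| ≤ 1 / 10)
    (hh' : |h'| ≤ 1 / 10) (hρ : 0 ≤ ρ) (hρ' : 0 ≤ ρ') (h1 : h ^ 2 + ρ ^ 2 = 1)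
    (h2 : h' ^ 2 + ρ' ^ 2 = 1) : 1 / 2 < c * (ρ * ρ') + h * h' := by
  have hh1 := (abs_le.1 hh).1
  have hh2 := (abs_le.1 hh).2
  have hh1' := (abs_le.1 hh').1
  have hh2' := (abs_le.1 hh').2
  have hhh : -(1 / 100) ≤ h * h' := by
    nlinarith [mul_nonneg (show (0:ℝ) ≤ 1/10 + h by linarith) (show (0:ℝ) ≤ 1/10 - h' by linarith),
      mul_nonneg (show (0:ℝ) ≤ 1/10 - h by linarith) (show (0:ℝ) ≤ 1/10 + h' by linarith)]
  have hρ2 : 99 / 100 ≤ ρ ^ 2 := by nlinarith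
  have hρ2' : 99 / 100 ≤ ρ' ^ 2 := by nlinarith
  have hρρ0 : 0 ≤ ρ * ρ' := mul_nonneg hρ hρ'
  have h3 : (99 / 100 : ℝ) * (99 / 100) ≤ (ρ * ρ') ^ 2 := by
    rw [mul_pow]; exact mul_le_mul hρ2 hρ2' (by norm_num) (sq_nonneg _)
  have hρρ : 99 / 100 ≤ ρ * ρ' := by
    by_contra hlt
    push Not at hlt
    nlinarith [mul_pos (show (0:ℝ) < 99 / 100 - ρ * ρ' by linarith)
      (show (0:ℝ) < 99 / 100 + ρ * ρ' by linarith)]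
  nlinarith

/-! ### The weighted azimuthal cycle -/

/-- **Weighted cycle.**  Points `0, …, m` carry azimuths `t 0 ≤ … ≤ t m` in `[0, 2π)` relative to a
distinguished point at azimuth `0` with weight `ws`; if the first gap exceeds `ws + w 0`, each
consecutive gap exceeds `w i + w (i+1)`, and the closing gap exceeds `w m + ws`, then
`2 ws + 2 Σ w < 2π`. -/
theorem weighted_cycle (m : ℕ) (t w : ℕ → ℝ) (ws : ℝ) (h0 : ws + w 0 < t 0)
    (hgap : ∀ i, i + 1 ≤ m → w i + w (i + 1) < t (i + 1) - t i)
    (hlast : w m + ws < 2 * Real.pi - t m) :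
    2 * ws + 2 * ∑ i ∈ Finset.range (m + 1), w i < 2 * Real.pi := by
  have htel : ∑ i ∈ Finset.range m, (t (i + 1) - t i) = t m - t 0 := Finset.sum_range_sub t m
  have hle : ∑ i ∈ Finset.range m, (w i + w (i + 1)) ≤ ∑ i ∈ Finset.range m, (t (i + 1) - t i) :=
    Finset.sum_le_sum fun i hi => (hgap i (by have := Finset.mem_range.1 hi; omega)).le
  have h1 : ∑ i ∈ Finset.range (m + 1), w i = ∑ i ∈ Finset.range m, w i + w m :=
    Finset.sum_range_succ w m
  have h2 : ∑ i ∈ Finset.range (m + 1), w i = ∑ i ∈ Finset.range m, w (i + 1) + w 0 :=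
    Finset.sum_range_succ' w m
  have h3 : ∑ i ∈ Finset.range m, (w i + w (i + 1)) =
      ∑ i ∈ Finset.range m, w i + ∑ i ∈ Finset.range m, w (i + 1) := Finset.sum_add_distrib
  linarith

end Summit.Ventures.Crystal3D.Theorems

end
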